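import Literature.NumberTheory.LFunctions.SelbergApproxPointwise
import Literature.NumberTheory.LFunctions.SelbergSigmaXTMoments
import Literature.NumberTheory.LFunctions.SelbergMeanSquareSteps
import Literature.NumberTheory.LFunctions.SelbergFujiiApproxFormula
import HarnessLib

/-!
# Selberg's approximate formula for `S(t)` in mean square, from the zero-density theorem near `σ = 1/2`

Topic `Literature/NumberTheory/LFunctions`. Everything in this file is PROVED (theorems only; no
definitions, no named facts). This is the assembly file of the unconditional half of the
Selberg–Fujii cluster (`ZeroGaps.lean`: the named facts
`Literature.NumberTheory.LFunctions.selberg_fujii_large_gaps` (Titchmarsh (9.25.5)) and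
`Literature.NumberTheory.LFunctions.selberg_fujii_small_gaps` ((9.25.6))).

**Main result** (`approxFormula_meanSquare_of_zeroDensity`). Assume Selberg's zero-density theorem
near the critical line in the printed shape of Titchmarsh's Theorem 9.19 (C) with an unspecified
exponent: for some `κ > 0`, `C`, `T₀`,
`N(σ, T) ≤ C T^{1 − κ(σ − 1/2)} log T` for `T ≥ T₀`, `1/2 ≤ σ ≤ 1`. Then Selberg's approximate formula
holds in mean square: there are `0 < a < b ≤ 1/4`, `C'`, `T₀'` with

  `∫_{T/2}^{T} ( S(t) + π⁻¹ Σ_{p ≤ y} sin(t log p)/√p )² dt ≤ C' T`   (`T ≥ T₀'`, `T^a ≤ y ≤ T^b`),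

which is exactly the hypothesis `hAF` of
`Literature.NumberTheory.LFunctions.selberg_fujii_large_gaps_of_approxFormula` and
`…small_gaps_of_approxFormula` (`SelbergFujiiApproxFormula.lean`). Hence
(`selberg_fujii_large_gaps_of_zeroDensity`, `selberg_fujii_small_gaps_of_zeroDensity`) both gap facts
follow from the zero-density theorem alone (Selberg 1946, Thm. 1 = Titchmarsh Thm. 9.19 (C), stated
in Titchmarsh without proof; it is being proved in the tree through §§9.20–9.24 and is NOT vendored
as a named fact here).

**Proof** (Selberg, *Contributions* §§5–6, in the arrangement of Titchmarsh §§14.21–14.22 with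
Selberg's moving abscissa `σ_{x,t} = 1/2 + δ(t)`, `x = T^θ`, `ℓ = log x = θ log T`,
`θ = min(κ/4, 1/16)`). For `t ∈ [T/2, T]` not an ordinate, the pointwise approximate formula
`SelbergApprox.selberg_approx_pointwise` (`SelbergApproxPointwise.lean`) gives
`|π S(t) − Im M(t)| ≤ C₀ δ(t) (‖D(s₁)‖ + log t)` with `M = Σ_{n < x³} Λ(n) f(log n) n^{−s₁}/log n`,
`D = Σ_{n<x³} Λ(n) f(log n) n^{−s₁}`, `s₁ = 1/2 + δ(t) + it`. Split `M` and `D` into primes and higher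
prime powers (`SelbergMeanSquare.msum_eq`, `SelbergMeanSquare.fordK_eq`, in `SelbergMeanSquareSteps.lean`): the prime parts are the polynomials
`P_j(u, t) = Σ_p (−log p)^j f(log p) p^{−1/2−u−it}` of `SelbergMeanSquareEngine.lean` at the moving
point `u = δ(t)`; the higher prime powers are `O(log T)` pointwise (`SelbergPrimeSumEstimates.lean`),
harmless against the factor `δ(t)` whose moments are `∫ δ^m ≪ T/ℓ^m`
(`SelbergMoments.integral_delta_pow_le`, from the density hypothesis). Since `f(log p) = 1` for
`p ≤ y ≤ x`, `π(S(t) + π⁻¹Σ_{p≤y} sin(t log p)/√p) = (πS − Im M) + Im (P₀(δ(t), t) − Σ_{p≤y} p^{−1/2−it}) + Im Q(t)`.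
The dependence on the moving point is removed by the Sobolev–Markov inequality in `u` followed by
Fubini and Cauchy–Schwarz against the fourth moments of the prime polynomials
(`SelbergEngine.norm_sq_le_sobolev_markov`, `SelbergEngine.integral_mul_integral_le`,
`SelbergEngine.integral_norm_dirPoly_pow_four_le`) and the Chebyshev–Mertens coefficient bounds
`Σ_p log^{2j} p · p^{−1−2u} ≪ u^{−2j}` (`SelbergPrimes.sum_log_pow_mul_rpow_le`); at the fixed point
`u = 4/ℓ` the coefficients `(f(log p)p^{−4/ℓ} − 1_{p ≤ y}) p^{−1/2}` have `Σ |·|² = O(1)` by Mertens'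
theorems, uniformly in `T^{θ/2} ≤ y ≤ T^θ`.

## References

* A. Selberg, *Contributions to the theory of the Riemann zeta-function*, Arch. Math. Naturvid. 48
  (1946) no. 5, 89–155, Thm. 1 and §§5–6.
* E. C. Titchmarsh, *The Theory of the Riemann Zeta-Function*, 2nd ed. rev. D. R. Heath-Brown (1986),
  Thm. 9.19 (C), §9.25 (9.25.2)–(9.25.6), §§14.21–14.22. [cite: Titchmarsh1986, §9.25]
* A. Fujii, *On the difference between r consecutive ordinates of the zeros of the Riemann zeta
  function*, Proc. Japan Acad. 51 (1975), 741–743.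
-/

noncomputable section

open Real MeasureTheory Set Filter Complex intervalIntegral
open scoped ComplexConjugate

namespace Literature.NumberTheory.LFunctions

namespace SelbergMeanSquare

open SelbergEngine SelbergExplicit

/-! ### §6 Assembly: the mean-square approximate formula from the zero-density theorem -/

/-- Numerical thresholds: for `T ≥ 16384`, `64 √T ≤ T` and `log T ≤ 8 T^{1/8}`, whence
`8 T^{3/8} log T ≤ T`. [folklore] -/
theorem eight_rpow_mul_log_le {T : ℝ} (hT : 16384 ≤ T) :
    8 * T ^ (3 / 8 : ℝ) * Real.log T ≤ T := by
  have hT0 : 0 < T := by linarith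
  have hlog : Real.log T ≤ T ^ (1 / 8 : ℝ) / (1 / 8) := Real.log_le_rpow_div hT0.le (by norm_num)
  have h18 : 0 ≤ T ^ (1 / 8 : ℝ) := Real.rpow_nonneg hT0.le _
  have h38 : 0 ≤ T ^ (3 / 8 : ℝ) := Real.rpow_nonneg hT0.le _
  have hhalf : T ^ (3 / 8 : ℝ) * T ^ (1 / 8 : ℝ) = T ^ (1 / 2 : ℝ) := by
    rw [← Real.rpow_add hT0]; norm_num
  have hsqrt : T ^ (1 / 2 : ℝ) * T ^ (1 / 2 : ℝ) = T := by
    rw [← Real.rpow_add hT0]; norm_num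
  have h64 : 64 ≤ T ^ (1 / 2 : ℝ) := by
    rw [← Real.sqrt_eq_rpow, Real.le_sqrt (by norm_num) hT0.le]; norm_num; linarith
  calc 8 * T ^ (3 / 8 : ℝ) * Real.log T ≤ 8 * T ^ (3 / 8 : ℝ) * (T ^ (1 / 8 : ℝ) / (1 / 8)) := by gcongr
    _ = 64 * T ^ (1 / 2 : ℝ) := by rw [← hhalf]; ring
    _ ≤ T ^ (1 / 2 : ℝ) * T ^ (1 / 2 : ℝ) := by nlinarith
    _ = T := hsqrt

set_option maxHeartbeats 400000 in
/-- **Selberg's approximate formula for `S(t)` in mean square, from the zero-density theorem near the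
critical line** (Selberg 1946; Titchmarsh §14.22 / §9.25): if for some `κ > 0`, `C`, `T₀`,
`N(σ, T) ≤ C T^{1−κ(σ−1/2)} log T` for all `T ≥ T₀` and `1/2 ≤ σ ≤ 1` (Titchmarsh's Theorem 9.19 (C) has
`κ = 1/4`), then there are `0 < a < b ≤ 1/4`, `C'`, `T₀'` with
`∫_{T/2}^{T} (S(t) + π⁻¹ Σ_{p ≤ y} sin(t log p)/√p)² dt ≤ C' T` for `T ≥ T₀'`, `T^a ≤ y ≤ T^b`
(namely `a = θ/2`, `b = θ`, `θ = min(κ/4, 1/16)`). This is the hypothesis `hAF` of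
`selberg_fujii_large_gaps_of_approxFormula`. [cite: Titchmarsh1986, §9.25] -/
theorem approxFormula_meanSquare_of_zeroDensity
    (hD : ∃ κ : ℝ, 0 < κ ∧ ∃ C T₀ : ℝ, ∀ T : ℝ, T₀ ≤ T → ∀ σ : ℝ, 1 / 2 ≤ σ → σ ≤ 1 →
      (zetaZeroCountRe σ T : ℝ) ≤ C * T ^ (1 - κ * (σ - 1 / 2)) * Real.log T) :
    ∃ a b : ℝ, 0 < a ∧ a < b ∧ b ≤ 1 / 4 ∧ ∃ C : ℝ, ∃ T₀ : ℝ, ∀ T : ℝ, T₀ ≤ T →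
      ∀ y : ℝ, T ^ a ≤ y → y ≤ T ^ b →
        ∫ t in T / 2..T, (zetaArgS t + π⁻¹ * ∑ p ∈ Nat.primesLE ⌊y⌋₊,
          Real.sin (t * Real.log p) / Real.sqrt p) ^ 2 ≤ C * T := by
  classical
  obtain ⟨κ, hκ, C_D, T_D, hD⟩ := hD
  -- a non-negative density constant, valid for `T ≥ max T_D 1`
  set C' : ℝ := max C_D 0 with hC'
  have hC'0 : 0 ≤ C' := le_max_right _ _
  have hD' : ∀ T : ℝ, max T_D 1 ≤ T → ∀ σ : ℝ, 1 / 2 ≤ σ → σ ≤ 1 →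
      (zetaZeroCountRe σ T : ℝ) ≤ C' * T ^ (1 - κ * (σ - 1 / 2)) * Real.log T := by
    intro T hT σ h1 h2
    have hT1 : 1 ≤ T := (le_max_right _ _).trans hT
    refine (hD T ((le_max_left _ _).trans hT) σ h1 h2).trans ?_
    have : 0 ≤ T ^ (1 - κ * (σ - 1 / 2)) * Real.log T :=
      mul_nonneg (Real.rpow_nonneg (by linarith only [hT1]) _) (Real.log_nonneg hT1)
    rw [mul_assoc, mul_assoc]
    exact mul_le_mul_of_nonneg_right (le_max_left _ _) this
  -- the exponent `θ`
  set θ : ℝ := min (κ / 4) (1 / 16) with hθ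
  have hθ0 : 0 < θ := lt_min (by positivity) (by norm_num)
  have hθκ : 3 * θ < κ := by
    have : θ ≤ κ / 4 := min_le_left _ _; linarith only [this, hκ]
  have hθ16 : θ ≤ 1 / 16 := min_le_right _ _
  have hθ3 : θ ≤ 1 / 3 := by linarith only [hθ16]
  -- the moments of `δ`
  obtain ⟨K₂, T₂, hK₂⟩ := SelbergMoments.integral_delta_pow_le hκ hC'0 hD' hθ0 hθκ hθ3 (m := 2) (by norm_num)
  obtain ⟨K₄, T₄, hK₄⟩ := SelbergMoments.integral_delta_pow_le hκ hC'0 hD' hθ0 hθκ hθ3 (m := 4) (by norm_num)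
  obtain ⟨K₆, T₆, hK₆⟩ := SelbergMoments.integral_delta_pow_le hκ hC'0 hD' hθ0 hθκ hθ3 (m := 6) (by norm_num)
  set K₂' := max K₂ 0 with hK₂'
  set K₄' := max K₄ 0 with hK₄'
  set K₆' := max K₆ 0 with hK₆'
  have hK₂'0 : 0 ≤ K₂' := le_max_right _ _
  have hK₄'0 : 0 ≤ K₄' := le_max_right _ _
  have hK₆'0 : 0 ≤ K₆' := le_max_right _ _
  -- the pointwise approximate formula
  obtain ⟨C₀, hC₀, hB2⟩ := SelbergApprox.selberg_approx_pointwise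
  -- the constant and the threshold
  set Cfin : ℝ := 2 * C₀ ^ 2 * (11 * Real.sqrt K₄' + 6 * Real.sqrt K₆' + 4 * (K₂' / θ ^ 2)) +
    (52 + 8 * Real.sqrt K₄') + (8 + 2 * K₂' / θ ^ 2) with hCfin
  set T₀ : ℝ := max (max (max T₂ T₄) T₆) (max (Real.exp (8 / θ)) 16384) with hT₀
  refine ⟨θ / 2, θ, by positivity, by linarith only [hθ0], by linarith only [hθ16], Cfin, T₀,
    fun T hT y hy1 hy2 ↦ ?_⟩
  -- unpack the threshold
  have hT2 : T₂ ≤ T := le_trans (le_trans (le_max_left _ _) (le_max_left _ _)) (le_trans (le_max_left _ _) hT)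
  have hT4 : T₄ ≤ T := le_trans (le_trans (le_max_right _ _) (le_max_left _ _)) (le_trans (le_max_left _ _) hT)
  have hT6 : T₆ ≤ T := le_trans (le_max_right _ _) (le_trans (le_max_left _ _) hT)
  have hTexp : Real.exp (8 / θ) ≤ T := le_trans (le_max_left _ _) (le_trans (le_max_right _ _) hT)
  have hT16384 : (16384 : ℝ) ≤ T := le_trans (le_max_right _ _) (le_trans (le_max_right _ _) hT)
  have hT0 : 0 < T := by linarith only [hT16384]
  have hT1 : 1 ≤ T := by linarith only [hT16384]
  have hTT : T / 2 ≤ T := by linarith only [hT16384]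
  -- `L = log T`, `ℓ = θ L`
  set L : ℝ := Real.log T with hL
  set ℓ : ℝ := θ * Real.log T with hℓ
  have hL8 : 8 / θ ≤ L := by
    rw [hL, ← Real.log_exp (8 / θ)]; exact Real.log_le_log (Real.exp_pos _) hTexp
  have hℓθL : ℓ = θ * L := by rw [hℓ, hL]
  have hℓ8 : 8 ≤ ℓ := by
    rw [hℓθL]
    have := mul_le_mul_of_nonneg_left hL8 hθ0.le
    rwa [mul_div_cancel₀ _ hθ0.ne'] at this
  have hℓ4 : 4 < ℓ := by linarith only [hℓ8]
  have hℓ0 : 0 < ℓ := by linarith only [hℓ8]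
  have hLnn : 0 ≤ L := by rw [hL]; exact Real.log_nonneg hT1
  have hℓL : ℓ ≤ L / 16 := by rw [hℓθL]; nlinarith only [hθ16, hLnn]
  have hL128 : 128 ≤ L := by linarith only [hℓL, hℓ8]
  have hL0 : 0 < L := by linarith only [hL128]
  -- `M₀ = ⌊e^{3ℓ}⌋`, `N = M₀ + 1`
  set M₀ : ℕ := ⌊Real.exp (3 * ℓ)⌋₊ with hM₀
  have hexp1 : 1 ≤ Real.exp (3 * ℓ) := Real.one_le_exp (by positivity)
  have hM₀le : (M₀ : ℝ) ≤ Real.exp (3 * ℓ) := Nat.floor_le (by positivity)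
  have hM₀lt : Real.exp (3 * ℓ) < (M₀ : ℝ) + 1 := Nat.lt_floor_add_one _
  have hM₀1 : 1 ≤ M₀ := Nat.le_floor (by simpa using hexp1)
  have hM₀pos : (0 : ℝ) < M₀ := by exact_mod_cast hM₀1
  have hM₀one : (1 : ℝ) ≤ M₀ := by exact_mod_cast hM₀1
  have hN2 : 2 ≤ M₀ + 1 := by omega
  have hcastN : ((M₀ + 1 : ℕ) : ℝ) = (M₀ : ℝ) + 1 := by push_cast; ring
  have hlogN : 3 * ℓ ≤ Real.log ((M₀ + 1 : ℕ) : ℝ) := by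
    rw [hcastN, ← Real.log_exp (3 * ℓ)]
    exact Real.log_le_log (Real.exp_pos _) hM₀lt.le
  have hlogN' : Real.log ((M₀ + 1 : ℕ) : ℝ) ≤ 3 * ℓ + 1 := by
    have h1 : (M₀ : ℝ) + 1 ≤ 2 * Real.exp (3 * ℓ) := by linarith only [hM₀le, hexp1]
    have h2 := Real.log_le_log (by positivity) h1
    rw [Real.log_mul (by norm_num) (Real.exp_pos _).ne', Real.log_exp] at h2
    rw [hcastN]
    have := Real.log_two_lt_d9; linarith only [h2, this]
  have h46 : 4 * Real.log ((M₀ + 1 : ℕ) : ℝ) + 6 ≤ L := by linarith only [hlogN', hℓL, hL128]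
  -- `e^{3ℓ} = T^{3θ}` and the size conditions
  have hexp3 : Real.exp (3 * ℓ) = T ^ (3 * θ) := by
    rw [Real.rpow_def_of_pos hT0, hℓ]; congr 1; ring
  have hM₀sq : (M₀ : ℝ) ^ 2 ≤ T ^ (3 / 8 : ℝ) := by
    calc (M₀ : ℝ) ^ 2 ≤ Real.exp (3 * ℓ) ^ 2 := pow_le_pow_left₀ hM₀pos.le hM₀le 2
      _ = T ^ (6 * θ) := by
          rw [hexp3, ← Real.rpow_natCast, ← Real.rpow_mul hT0.le]; congr 1; push_cast; ring
      _ ≤ T ^ (3 / 8 : ℝ) := Real.rpow_le_rpow_of_exponent_le hT1 (by linarith only [hθ16])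
  have hlogM₀sq : Real.log ((M₀ : ℝ) ^ 2) ≤ 6 * ℓ := by
    calc Real.log ((M₀ : ℝ) ^ 2) ≤ Real.log (Real.exp (3 * ℓ) ^ 2) :=
          Real.log_le_log (by positivity) (pow_le_pow_left₀ hM₀pos.le hM₀le 2)
      _ = 6 * ℓ := by rw [Real.log_pow, Real.log_exp]; push_cast; ring
  have hlogM₀sq0 : 0 ≤ Real.log ((M₀ : ℝ) ^ 2) := by rw [← Nat.cast_pow]; exact Real.log_natCast_nonneg _
  have hsize : 8 * (M₀ : ℝ) ^ 2 * (1 + Real.log ((M₀ : ℝ) ^ 2)) ≤ T / 2 := by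
    have h1 : 1 + Real.log ((M₀ : ℝ) ^ 2) ≤ L / 2 := by linarith only [hlogM₀sq, hℓL, hL128]
    have h3 := eight_rpow_mul_log_le hT16384
    rw [← hL] at h3
    have h38 : 0 ≤ T ^ (3 / 8 : ℝ) := Real.rpow_nonneg hT0.le _
    calc 8 * (M₀ : ℝ) ^ 2 * (1 + Real.log ((M₀ : ℝ) ^ 2)) ≤ 8 * T ^ (3 / 8 : ℝ) * (L / 2) :=
          mul_le_mul (mul_le_mul_of_nonneg_left hM₀sq (by norm_num)) h1 (by linarith only [hlogM₀sq0])
            (by positivity)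
      _ = (8 * T ^ (3 / 8 : ℝ) * L) / 2 := by ring
      _ ≤ T / 2 := by linarith only [h3]
  have hlM1 : 0 ≤ 1 + Real.log (M₀ : ℝ) := by linarith only [Real.log_nonneg hM₀one]
  have hsize1 : 8 * (M₀ : ℝ) * (1 + Real.log (M₀ : ℝ)) ≤ T / 2 := by
    have h1 : (M₀ : ℝ) ≤ (M₀ : ℝ) ^ 2 := by nlinarith only [hM₀one]
    have h2 : Real.log (M₀ : ℝ) ≤ Real.log ((M₀ : ℝ) ^ 2) := Real.log_le_log hM₀pos h1
    calc 8 * (M₀ : ℝ) * (1 + Real.log (M₀ : ℝ)) ≤ 8 * (M₀ : ℝ) ^ 2 * (1 + Real.log ((M₀ : ℝ) ^ 2)) :=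
          mul_le_mul (mul_le_mul_of_nonneg_left h1 (by norm_num)) (by linarith only [h2]) hlM1 (by positivity)
      _ ≤ T / 2 := hsize
  have hTM : T / 2 + 8 * (M₀ : ℝ) * (1 + Real.log (M₀ : ℝ)) ≤ T := by linarith only [hsize1]
  have hTM0 : 0 ≤ T / 2 + 8 * (M₀ : ℝ) * (1 + Real.log (M₀ : ℝ)) :=
    add_nonneg (by positivity) (mul_nonneg (by positivity) hlM1)
  -- facts about `y`
  have hlogy1 : ℓ / 2 ≤ Real.log y := by
    have h1 : Real.log (T ^ (θ / 2)) = ℓ / 2 := by rw [Real.log_rpow hT0, hℓ]; ring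
    rw [← h1]; exact Real.log_le_log (Real.rpow_pos_of_pos hT0 _) hy1
  have hypos : 0 < y := lt_of_lt_of_le (Real.rpow_pos_of_pos hT0 _) hy1
  have hlogy2 : Real.log y ≤ ℓ := by
    have h1 : Real.log (T ^ θ) = ℓ := by rw [Real.log_rpow hT0, hℓ]
    rw [← h1]; exact Real.log_le_log hypos hy2
  have hly0 : 0 < Real.log y := by linarith only [hlogy1, hℓ8]
  have hy2 : 2 ≤ y := by
    by_contra h
    push Not at h
    have h' : Real.log y < Real.log 2 := Real.log_lt_log hypos h
    have := Real.log_two_lt_d9; linarith only [h', this, hlogy1, hℓ8]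
  have hyexp : y ≤ Real.exp ℓ := by
    rw [← Real.log_le_iff_le_exp hypos]; exact hlogy2
  have hyM : y ≤ (M₀ : ℝ) := by
    have h1 : Real.exp (3 * ℓ) - 1 ≤ M₀ := by linarith only [hM₀lt]
    have h3 : Real.exp (3 * ℓ) = Real.exp ℓ * Real.exp (2 * ℓ) := by rw [← Real.exp_add]; congr 1; ring
    have h4 : 2 ≤ Real.exp (2 * ℓ) := by
      have := Real.add_one_le_exp (2 * ℓ); linarith only [this, hℓ8]
    have h5 : 1 ≤ Real.exp ℓ := Real.one_le_exp hℓ0.le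
    nlinarith only [hyexp, h1, h3, h4, h5]
  have hKM : ⌊y⌋₊ ≤ M₀ := Nat.floor_le_floor (hyexp.trans (Real.exp_le_exp.2 (by linarith only [hℓ0])))
  -- the weights
  have hwf0 : ∀ n : ℕ, 0 ≤ smoothing ℓ (Real.log n) := fun n ↦ smoothing_nonneg hℓ0 _
  have hwf1 : ∀ n : ℕ, smoothing ℓ (Real.log n) ≤ 1 := fun n ↦ smoothing_le_one hℓ0 _
  have hwfabs : ∀ n : ℕ, |((fun n ↦ smoothing ℓ (Real.log n))) n| ≤ 1 := fun n ↦ by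
    dsimp only; rw [abs_of_nonneg (hwf0 n)]; exact hwf1 n
  have hwfy : ∀ p ∈ Nat.primesLE ⌊y⌋₊, ((fun n ↦ smoothing ℓ (Real.log n))) p = 1 := by
    intro p hp
    have hpp := (Nat.mem_primesLE.1 hp).2
    have hpK := (Nat.mem_primesLE.1 hp).1
    have hp0 : (0 : ℝ) < p := by exact_mod_cast hpp.pos
    have hpy : (p : ℝ) ≤ y := (Nat.le_floor_iff hypos.le).1 hpK
    have : Real.log p ≤ ℓ := (Real.log_le_log hp0 hpy).trans hlogy2
    exact smoothing_eq_one hℓ0 this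
  -- the sets
  have hS0 : ∀ n ∈ (Nat.primesLE M₀), n ≠ 0 := fun n hn ↦ (Nat.mem_primesLE.1 hn).2.ne_zero
  have hA0 : ∀ n ∈ ((Finset.Ico 2 (M₀ + 1)).filter (fun n ↦ ¬ n.Prime)), n ≠ 0 := fun n hn ↦ by
    rw [Finset.mem_filter, Finset.mem_Ico] at hn; omega
  have hAsub : ((Finset.Ico 2 (M₀ + 1)).filter (fun n ↦ ¬ n.Prime)) ⊆ Finset.Icc 1 M₀ := fun n hn ↦ by
    rw [Finset.mem_filter, Finset.mem_Ico] at hn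
    exact Finset.mem_Icc.2 ⟨by omega, by omega⟩
  have hSsub : (Nat.primesLE M₀) ⊆ Finset.Icc 1 M₀ := fun n hn ↦ by
    have := Nat.mem_primesLE.1 hn
    exact Finset.mem_Icc.2 ⟨this.2.one_lt.le, this.1⟩
  -- Selberg's `δ`
  have hδa : ∀ t, 4 / ℓ ≤ SelbergSigma.delta ℓ t := fun t ↦ SelbergSigma.four_div_le_delta ℓ t
  have hδ1 : ∀ t, SelbergSigma.delta ℓ t ≤ 1 := fun t ↦ (SelbergSigma.delta_lt_one hℓ4 t).le
  have hδ0 : ∀ t, 0 ≤ SelbergSigma.delta ℓ t := fun t ↦ le_trans (by positivity) (hδa t)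
  have hδm : Measurable fun t ↦ SelbergSigma.delta ℓ t := SelbergSigma.measurable_delta ℓ
  have hδpow1 : ∀ t (k : ℕ), SelbergSigma.delta ℓ t ^ k ≤ 1 := fun t k ↦ pow_le_one₀ (hδ0 t) (hδ1 t)
  -- the moment bounds at this `T`
  have h2m : ∫ t in T / 2..T, SelbergSigma.delta ℓ t ^ 2 ≤ K₂' * T / ℓ ^ 2 := by
    have h := hK₂ T hT2
    rw [← hℓ] at h
    refine h.trans ?_
    gcongr; exact le_max_left _ _
  have h4m : ∫ t in T / 2..T, SelbergSigma.delta ℓ t ^ 4 ≤ K₄' * T / ℓ ^ 4 := by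
    have h := hK₄ T hT4
    rw [← hℓ] at h
    refine h.trans ?_
    gcongr; exact le_max_left _ _
  have h6m : ∫ t in T / 2..T, SelbergSigma.delta ℓ t ^ 6 ≤ K₆' * T / ℓ ^ 6 := by
    have h := hK₆ T hT6
    rw [← hℓ] at h
    refine h.trans ?_
    gcongr; exact le_max_left _ _
  have hsqrt4 : Real.sqrt (K₄' * T / ℓ ^ 4) = Real.sqrt K₄' * Real.sqrt T / ℓ ^ 2 := by
    rw [Real.sqrt_div (by positivity), Real.sqrt_mul hK₄'0, show ℓ ^ 4 = (ℓ ^ 2) ^ 2 by ring,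
      Real.sqrt_sq (by positivity)]
  have hsqrt6 : Real.sqrt (K₆' * T / ℓ ^ 6) = Real.sqrt K₆' * Real.sqrt T / ℓ ^ 3 := by
    rw [Real.sqrt_div (by positivity), Real.sqrt_mul hK₆'0, show ℓ ^ 6 = (ℓ ^ 3) ^ 2 by ring,
      Real.sqrt_sq (by positivity)]
  have hsqT : Real.sqrt T * Real.sqrt T = T := Real.mul_self_sqrt hT0.le
  -- the objects of the decomposition (opaque abbreviations)
  obtain ⟨P, hP⟩ : ∃ P : ℝ → ℂ, P = fun t ↦ dirPoly (Nat.primesLE M₀) (fun n ↦ smoothing ℓ (Real.log n)) 0 (SelbergSigma.delta ℓ t) t - dirPoly (Nat.primesLE M₀) (fun n : ℕ ↦ if n ≤ ⌊y⌋₊ then (1 : ℝ) else 0) 0 0 t := ⟨_, rfl⟩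
  obtain ⟨Q1, hQ1⟩ : ∃ Q1 : ℝ → ℂ, Q1 = fun t ↦ dirPoly (Nat.primesLE M₀) (fun n ↦ smoothing ℓ (Real.log n)) 1 (SelbergSigma.delta ℓ t) t := ⟨_, rfl⟩
  obtain ⟨Qn, hQn⟩ : ∃ Qn : ℝ → ℂ, Qn = fun t ↦ dirPoly ((Finset.Ico 2 (M₀ + 1)).filter (fun n ↦ ¬ n.Prime)) (fun n ↦ ArithmeticFunction.vonMangoldt n * smoothing ℓ (Real.log n) / Real.log n) 0 (SelbergSigma.delta ℓ t) t := ⟨_, rfl⟩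
  obtain ⟨Qn0, hQn0⟩ : ∃ Qn0 : ℝ → ℂ, Qn0 = fun t ↦ dirPoly ((Finset.Ico 2 (M₀ + 1)).filter (fun n ↦ ¬ n.Prime)) (fun n ↦ ArithmeticFunction.vonMangoldt n * smoothing ℓ (Real.log n) / Real.log n) 0 0 t := ⟨_, rfl⟩
  obtain ⟨E, hE⟩ : ∃ E : ℝ → ℝ, E = fun t ↦ zetaArgS t + π⁻¹ * ∑ p ∈ Nat.primesLE ⌊y⌋₊,
    Real.sin (t * Real.log p) / Real.sqrt p := ⟨_, rfl⟩
  obtain ⟨R, hR⟩ : ∃ R : ℝ → ℝ, R = fun t ↦ 2 * C₀ ^ 2 * (SelbergSigma.delta ℓ t ^ 2 * ‖Q1 t‖ ^ 2 + 4 * L ^ 2 * SelbergSigma.delta ℓ t ^ 2) +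
    ‖P t‖ ^ 2 + ‖Qn t‖ ^ 2 := ⟨_, rfl⟩
  have hP_eq : ∀ t, P t = dirPoly (Nat.primesLE M₀) (fun n ↦ smoothing ℓ (Real.log n)) 0 (SelbergSigma.delta ℓ t) t - dirPoly (Nat.primesLE M₀) (fun n : ℕ ↦ if n ≤ ⌊y⌋₊ then (1 : ℝ) else 0) 0 0 t := fun t ↦ by rw [hP]
  have hQ1_eq : ∀ t, Q1 t = dirPoly (Nat.primesLE M₀) (fun n ↦ smoothing ℓ (Real.log n)) 1 (SelbergSigma.delta ℓ t) t := fun t ↦ by rw [hQ1]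
  have hQn_eq : ∀ t, Qn t = dirPoly ((Finset.Ico 2 (M₀ + 1)).filter (fun n ↦ ¬ n.Prime)) (fun n ↦ ArithmeticFunction.vonMangoldt n * smoothing ℓ (Real.log n) / Real.log n) 0 (SelbergSigma.delta ℓ t) t := fun t ↦ by rw [hQn]
  have hQn0_eq : ∀ t, Qn0 t = dirPoly ((Finset.Ico 2 (M₀ + 1)).filter (fun n ↦ ¬ n.Prime)) (fun n ↦ ArithmeticFunction.vonMangoldt n * smoothing ℓ (Real.log n) / Real.log n) 0 0 t := fun t ↦ by rw [hQn0]
  have hE_eq : ∀ t, E t = zetaArgS t + π⁻¹ * ∑ p ∈ Nat.primesLE ⌊y⌋₊,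
      Real.sin (t * Real.log p) / Real.sqrt p := fun t ↦ by rw [hE]
  have hR_eq : ∀ t, R t = 2 * C₀ ^ 2 * (SelbergSigma.delta ℓ t ^ 2 * ‖Q1 t‖ ^ 2 + 4 * L ^ 2 * SelbergSigma.delta ℓ t ^ 2) +
      ‖P t‖ ^ 2 + ‖Qn t‖ ^ 2 := fun t ↦ by rw [hR]
  -- Step 1: the pointwise inequality off the ordinates
  have hpt : ∀ t ∈ Icc (T / 2) T, (∀ ρ : ℂ, riemannZeta ρ = 0 → ρ.im ≠ t) → E t ^ 2 ≤ R t := by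
    intro t ht hord
    have ht0 : 0 < t := by linarith only [ht.1, hT16384]
    have ht1 : 1 ≤ t := by linarith only [ht.1, hT16384]
    have hlogt : Real.log t ≤ L := by rw [hL]; exact Real.log_le_log ht0 ht.2
    have hlogt0 : 0 ≤ Real.log t := Real.log_nonneg ht1
    have hℓt : ℓ ≤ 2 * Real.log t := by
      have h1 : Real.log (T / 2) ≤ Real.log t := Real.log_le_log (by linarith only [hT16384]) ht.1
      rw [Real.log_div hT0.ne' two_ne_zero, ← hL] at h1
      have := Real.log_two_lt_d9
      linarith only [h1, this, hℓL, hL128]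
    -- the pointwise approximate formula, decomposed
    have hB := hB2 ℓ t hℓ8 ht0 hℓt hord (M₀ + 1) hN2 hlogN
    rw [msum_eq M₀ ℓ (SelbergSigma.delta ℓ t) t, fordK_eq hℓ0.le hlogN (SelbergSigma.delta ℓ t) t, ← hQ1_eq, ← hQn_eq] at hB
    -- the size of the higher prime powers and the sine sum
    have hDnp := norm_Dnp_le M₀ hℓ0 (hδ0 t) t
    have hsin := sum_sin_div_sqrt_eq hKM t
    -- `π E t = A₁ + Im P + Im Qn`
    have hEeq : π * E t = (π * zetaArgS t - (dirPoly (Nat.primesLE M₀) (fun n ↦ smoothing ℓ (Real.log n)) 0 (SelbergSigma.delta ℓ t) t + Qn t).im) +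
        (P t).im + (Qn t).im := by
      rw [hE_eq, hP_eq, mul_add, ← mul_assoc, mul_inv_cancel₀ Real.pi_pos.ne', one_mul, hsin,
        Complex.add_im, Complex.sub_im]
      ring
    -- `|A₁| ≤ C₀ δ (‖Q1‖ + 2L)`
    have hA₁le : |π * zetaArgS t - (dirPoly (Nat.primesLE M₀) (fun n ↦ smoothing ℓ (Real.log n)) 0 (SelbergSigma.delta ℓ t) t + Qn t).im| ≤
        C₀ * SelbergSigma.delta ℓ t * (‖Q1 t‖ + 2 * L) := by
      refine hB.trans (mul_le_mul_of_nonneg_left ?_ (mul_nonneg hC₀.le (hδ0 t)))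
      have h1 : ‖-Q1 t + dirPoly ((Finset.Ico 2 (M₀ + 1)).filter (fun n ↦ ¬ n.Prime)) (fun n ↦ ArithmeticFunction.vonMangoldt n * smoothing ℓ (Real.log n)) 0 (SelbergSigma.delta ℓ t) t‖ ≤ ‖Q1 t‖ + (4 * Real.log ((M₀ + 1 : ℕ) : ℝ) + 6) := by
        calc ‖-Q1 t + dirPoly ((Finset.Ico 2 (M₀ + 1)).filter (fun n ↦ ¬ n.Prime)) (fun n ↦ ArithmeticFunction.vonMangoldt n * smoothing ℓ (Real.log n)) 0 (SelbergSigma.delta ℓ t) t‖ ≤ ‖-Q1 t‖ + ‖dirPoly ((Finset.Ico 2 (M₀ + 1)).filter (fun n ↦ ¬ n.Prime)) (fun n ↦ ArithmeticFunction.vonMangoldt n * smoothing ℓ (Real.log n)) 0 (SelbergSigma.delta ℓ t) t‖ :=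
              norm_add_le _ _
          _ ≤ ‖Q1 t‖ + (4 * Real.log ((M₀ + 1 : ℕ) : ℝ) + 6) := by rw [norm_neg]; exact add_le_add le_rfl hDnp
      linarith only [h1, h46, hlogt]
    -- squares
    set A₁ : ℝ := π * zetaArgS t - (dirPoly (Nat.primesLE M₀) (fun n ↦ smoothing ℓ (Real.log n)) 0 (SelbergSigma.delta ℓ t) t + Qn t).im with hA₁
    have hA₁sq : A₁ ^ 2 ≤ 2 * C₀ ^ 2 * (SelbergSigma.delta ℓ t ^ 2 * ‖Q1 t‖ ^ 2 + 4 * L ^ 2 * SelbergSigma.delta ℓ t ^ 2) := by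
      have h1 : A₁ ^ 2 ≤ (C₀ * SelbergSigma.delta ℓ t * (‖Q1 t‖ + 2 * L)) ^ 2 := by
        rw [← sq_abs A₁]; exact pow_le_pow_left₀ (abs_nonneg _) hA₁le 2
      refine h1.trans ?_
      have h2 : (‖Q1 t‖ + 2 * L) ^ 2 ≤ 2 * ‖Q1 t‖ ^ 2 + 2 * (2 * L) ^ 2 := by
        nlinarith only [sq_nonneg (‖Q1 t‖ - 2 * L)]
      have h3 : 0 ≤ C₀ ^ 2 * SelbergSigma.delta ℓ t ^ 2 := by positivity
      calc (C₀ * SelbergSigma.delta ℓ t * (‖Q1 t‖ + 2 * L)) ^ 2 = C₀ ^ 2 * SelbergSigma.delta ℓ t ^ 2 * (‖Q1 t‖ + 2 * L) ^ 2 := by ring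
        _ ≤ C₀ ^ 2 * SelbergSigma.delta ℓ t ^ 2 * (2 * ‖Q1 t‖ ^ 2 + 2 * (2 * L) ^ 2) := mul_le_mul_of_nonneg_left h2 h3
        _ = 2 * C₀ ^ 2 * (SelbergSigma.delta ℓ t ^ 2 * ‖Q1 t‖ ^ 2 + 4 * L ^ 2 * SelbergSigma.delta ℓ t ^ 2) := by ring
    have hIm1 : |(P t).im| ≤ ‖P t‖ := Complex.abs_im_le_norm _
    have hIm2 : |(Qn t).im| ≤ ‖Qn t‖ := Complex.abs_im_le_norm _
    have hpiE : (π * E t) ^ 2 ≤ 3 * (A₁ ^ 2 + ‖P t‖ ^ 2 + ‖Qn t‖ ^ 2) := by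
      rw [hEeq]
      have h1 : (P t).im ^ 2 ≤ ‖P t‖ ^ 2 := by rw [← sq_abs]; exact pow_le_pow_left₀ (abs_nonneg _) hIm1 2
      have h2 : (Qn t).im ^ 2 ≤ ‖Qn t‖ ^ 2 := by rw [← sq_abs]; exact pow_le_pow_left₀ (abs_nonneg _) hIm2 2
      nlinarith only [sq_nonneg (A₁ - (P t).im), sq_nonneg (A₁ - (Qn t).im),
        sq_nonneg ((P t).im - (Qn t).im), h1, h2]
    have hpi3 : (3 : ℝ) ≤ π ^ 2 := by nlinarith only [Real.pi_gt_three]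
    have hX0 : 0 ≤ A₁ ^ 2 + ‖P t‖ ^ 2 + ‖Qn t‖ ^ 2 := by positivity
    have hpi0 : 0 < π ^ 2 := by positivity
    calc E t ^ 2 = (π * E t) ^ 2 / π ^ 2 := by field_simp
      _ ≤ 3 * (A₁ ^ 2 + ‖P t‖ ^ 2 + ‖Qn t‖ ^ 2) / π ^ 2 := by gcongr
      _ ≤ A₁ ^ 2 + ‖P t‖ ^ 2 + ‖Qn t‖ ^ 2 := by
          rw [div_le_iff₀ hpi0]; nlinarith only [hX0, hpi3]
      _ ≤ R t := by rw [hR_eq]; linarith only [hA₁sq]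
  -- Step 2: integrability and the a.e. inequality
  set BQ1 := ∑ p ∈ (Nat.primesLE M₀), Real.log p ^ 1 * |((fun n ↦ smoothing ℓ (Real.log n))) p| with hBQ1def
  have hBQ1 : ∀ t, ‖Q1 t‖ ≤ BQ1 := fun t ↦ by
    rw [hQ1_eq]; exact norm_dirPoly_le hS0 _ 1 (by linarith only [hδ0 t]) t
  set BP := (∑ p ∈ (Nat.primesLE M₀), Real.log p ^ 0 * |((fun n ↦ smoothing ℓ (Real.log n))) p|) + ∑ p ∈ (Nat.primesLE M₀), Real.log p ^ 0 * |((fun n : ℕ ↦ if n ≤ ⌊y⌋₊ then (1 : ℝ) else 0)) p|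
    with hBPdef
  have hBP : ∀ t, ‖P t‖ ≤ BP := fun t ↦ by
    rw [hP_eq]
    exact (norm_sub_le _ _).trans (add_le_add (norm_dirPoly_le hS0 _ 0 (by linarith only [hδ0 t]) t)
      (norm_dirPoly_le hS0 _ 0 (by norm_num) t))
  set BQn := ∑ n ∈ ((Finset.Ico 2 (M₀ + 1)).filter (fun n ↦ ¬ n.Prime)), Real.log n ^ 0 * |((fun n ↦ ArithmeticFunction.vonMangoldt n * smoothing ℓ (Real.log n) / Real.log n)) n| with hBQndef
  have hBQn : ∀ t, ‖Qn t‖ ≤ BQn := fun t ↦ by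
    rw [hQn_eq]; exact norm_dirPoly_le hA0 _ 0 (by linarith only [hδ0 t]) t
  have hBQn0 : ∀ t, ‖Qn0 t‖ ≤ BQn := fun t ↦ by
    rw [hQn0_eq]; exact norm_dirPoly_le hA0 _ 0 (by norm_num) t
  have hQ1m : Measurable Q1 := by rw [hQ1]; exact measurable_dirPoly_comp hS0 _ 1 hδm
  have hPm : Measurable P := by
    rw [hP]; exact (measurable_dirPoly_comp hS0 _ 0 hδm).sub (continuous_dirPoly_right hS0 _ 0 0).measurable
  have hQnm : Measurable Qn := by rw [hQn]; exact measurable_dirPoly_comp hA0 _ 0 hδm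
  have hQn0c : Continuous Qn0 := by rw [hQn0]; exact continuous_dirPoly_right hA0 _ 0 0
  have hI1 : IntervalIntegrable (fun t ↦ SelbergSigma.delta ℓ t ^ 2 * ‖Q1 t‖ ^ 2) volume (T / 2) T := by
    refine intervalIntegrable_of_bounded ((hδm.pow_const 2).mul (hQ1m.norm.pow_const 2)) hTT
      (M := 1 * BQ1 ^ 2) fun t _ ↦ ?_
    rw [Real.norm_eq_abs, abs_of_nonneg (mul_nonneg (sq_nonneg _) (sq_nonneg _))]
    exact mul_le_mul (hδpow1 t 2) (pow_le_pow_left₀ (norm_nonneg _) (hBQ1 t) 2) (sq_nonneg _) zero_le_one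
  have hI2 : IntervalIntegrable (fun t ↦ SelbergSigma.delta ℓ t ^ 2) volume (T / 2) T := by
    refine intervalIntegrable_of_bounded (hδm.pow_const 2) hTT (M := 1) fun t _ ↦ ?_
    rw [Real.norm_eq_abs, abs_of_nonneg (sq_nonneg _)]; exact hδpow1 t 2
  have hI3 : IntervalIntegrable (fun t ↦ ‖P t‖ ^ 2) volume (T / 2) T := by
    refine intervalIntegrable_of_bounded (hPm.norm.pow_const 2) hTT (M := BP ^ 2) fun t _ ↦ ?_
    rw [Real.norm_eq_abs, abs_of_nonneg (sq_nonneg _)]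
    exact pow_le_pow_left₀ (norm_nonneg _) (hBP t) 2
  have hI4 : IntervalIntegrable (fun t ↦ ‖Qn t‖ ^ 2) volume (T / 2) T := by
    refine intervalIntegrable_of_bounded (hQnm.norm.pow_const 2) hTT (M := BQn ^ 2) fun t _ ↦ ?_
    rw [Real.norm_eq_abs, abs_of_nonneg (sq_nonneg _)]
    exact pow_le_pow_left₀ (norm_nonneg _) (hBQn t) 2
  have hIA : IntervalIntegrable (fun t ↦ 2 * C₀ ^ 2 * (SelbergSigma.delta ℓ t ^ 2 * ‖Q1 t‖ ^ 2 + 4 * L ^ 2 * SelbergSigma.delta ℓ t ^ 2))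
      volume (T / 2) T := (hI1.add (hI2.const_mul _)).const_mul _
  have hIR : IntervalIntegrable R volume (T / 2) T := by
    rw [hR]; exact (hIA.add hI3).add hI4
  -- `E` is bounded and measurable
  have hsinc : Continuous fun t : ℝ ↦ ∑ p ∈ Nat.primesLE ⌊y⌋₊, Real.sin (t * Real.log p) / Real.sqrt p := by
    fun_prop
  have hEm : Measurable E := by
    rw [hE]; exact SelbergFujii.measurable_zetaArgS.add (measurable_const.mul hsinc.measurable)
  obtain ⟨CS, -, hCS⟩ := SelbergFujii.exists_abs_zetaArgS_le (T / 2) T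
  obtain ⟨CP, hCP⟩ := (isCompact_Icc (a := T / 2) (b := T)).exists_bound_of_continuousOn hsinc.continuousOn
  have hEbd : ∀ t ∈ Icc (T / 2) T, |E t| ≤ CS + |CP| := by
    intro t ht
    have h1 := hCS t ht
    have h2 := hCP t ht
    rw [Real.norm_eq_abs] at h2
    have h3 : |π⁻¹ * ∑ p ∈ Nat.primesLE ⌊y⌋₊, Real.sin (t * Real.log p) / Real.sqrt p| ≤ |CP| := by
      rw [abs_mul, abs_inv, abs_of_pos Real.pi_pos]
      calc π⁻¹ * |∑ p ∈ Nat.primesLE ⌊y⌋₊, Real.sin (t * Real.log p) / Real.sqrt p|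
          ≤ 1 * |∑ p ∈ Nat.primesLE ⌊y⌋₊, Real.sin (t * Real.log p) / Real.sqrt p| :=
            mul_le_mul_of_nonneg_right (inv_le_one_of_one_le₀ (by linarith only [Real.pi_gt_three])) (abs_nonneg _)
        _ ≤ |CP| := by rw [one_mul]; exact h2.trans (le_abs_self _)
    rw [hE_eq]
    exact (abs_add_le _ _).trans (add_le_add h1 h3)
  have hIE : IntervalIntegrable (fun t ↦ E t ^ 2) volume (T / 2) T := by
    refine intervalIntegrable_of_bounded (hEm.pow_const 2) hTT (M := (CS + |CP|) ^ 2) fun t ht ↦ ?_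
    rw [Real.norm_eq_abs, abs_pow, ← sq_abs (CS + |CP|)]
    exact pow_le_pow_left₀ (abs_nonneg _) ((hEbd t (Ioc_subset_Icc_self ht)).trans (le_abs_self _)) 2
  have hae : (fun t ↦ E t ^ 2) ≤ᵐ[volume.restrict (Icc (T / 2) T)] R := by
    rw [Filter.EventuallyLE, ae_restrict_iff' measurableSet_Icc]
    filter_upwards [ae_not_ordinate T] with t ht htI
    exact hpt t htI (ht (by linarith only [htI.1, hT16384]) htI.2)
  have hmono : ∫ t in T / 2..T, E t ^ 2 ≤ ∫ t in T / 2..T, R t :=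
    intervalIntegral.integral_mono_ae_restrict hTT hIE hIR hae
  -- Step 3: the four integrals
  -- (i) `∫ δ² ‖Q1‖²`
  have hInt1 : ∫ t in T / 2..T, SelbergSigma.delta ℓ t ^ 2 * ‖Q1 t‖ ^ 2 ≤ (11 * Real.sqrt K₄' + 6 * Real.sqrt K₆') * T := by
    have h := integral_delta_sq_mul_norm_sq_le (N := M₀) (fun n ↦ smoothing ℓ (Real.log n)) hwfabs hℓ4 hT0.le hsize h4m h6m
    rw [hsqrt4, hsqrt6] at h
    have e : ∫ t in T / 2..T, SelbergSigma.delta ℓ t ^ 2 * ‖Q1 t‖ ^ 2 =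
        ∫ t in T / 2..T, SelbergSigma.delta ℓ t ^ 2 * ‖dirPoly (Nat.primesLE M₀) (fun n ↦ smoothing ℓ (Real.log n)) 1 (SelbergSigma.delta ℓ t) t‖ ^ 2 :=
      intervalIntegral.integral_congr fun t _ ↦ by rw [hQ1_eq]
    rw [e]
    refine h.trans (le_of_eq ?_)
    have hℓ2 : ℓ ^ 2 ≠ 0 := by positivity
    have hℓ3 : ℓ ^ 3 ≠ 0 := by positivity
    have e1 : 11 * (Real.sqrt K₄' * Real.sqrt T / ℓ ^ 2) * Real.sqrt T * ℓ ^ 2 =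
        11 * Real.sqrt K₄' * (Real.sqrt T * Real.sqrt T) * (ℓ ^ 2 / ℓ ^ 2) := by ring
    have e2 : 6 * (Real.sqrt K₆' * Real.sqrt T / ℓ ^ 3) * Real.sqrt T * ℓ ^ 3 =
        6 * Real.sqrt K₆' * (Real.sqrt T * Real.sqrt T) * (ℓ ^ 3 / ℓ ^ 3) := by ring
    rw [e1, e2, hsqT, div_self hℓ2, div_self hℓ3]
    ring
  -- (ii) `L² ∫ δ²`
  have hInt2 : L ^ 2 * ∫ t in T / 2..T, SelbergSigma.delta ℓ t ^ 2 ≤ K₂' / θ ^ 2 * T := by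
    calc L ^ 2 * ∫ t in T / 2..T, SelbergSigma.delta ℓ t ^ 2 ≤ L ^ 2 * (K₂' * T / ℓ ^ 2) :=
          mul_le_mul_of_nonneg_left h2m (sq_nonneg L)
      _ = K₂' / θ ^ 2 * T := by rw [hℓθL]; field_simp
  -- (iii) `∫ ‖P‖²`
  have hInt3 : ∫ t in T / 2..T, ‖P t‖ ^ 2 ≤ (52 + 8 * Real.sqrt K₄') * T := by
    have h := integral_norm_sq_moving_sub_le (N := M₀) (fun n ↦ smoothing ℓ (Real.log n)) (fun n : ℕ ↦ if n ≤ ⌊y⌋₊ then (1 : ℝ) else 0) hwfabs hℓ4 hT0.le hsize h4m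
    rw [hsqrt4] at h
    -- the fixed-point polynomial
    have hfix : ∀ t, dirPoly (Nat.primesLE M₀) (fun n ↦ smoothing ℓ (Real.log n)) 0 (4 / ℓ) t - dirPoly (Nat.primesLE M₀) (fun n : ℕ ↦ if n ≤ ⌊y⌋₊ then (1 : ℝ) else 0) 0 0 t =
        dirPoly (Nat.primesLE M₀) (fun p ↦ ((fun n ↦ smoothing ℓ (Real.log n))) p * Real.exp (-(4 / ℓ * Real.log p)) - ((fun n : ℕ ↦ if n ≤ ⌊y⌋₊ then (1 : ℝ) else 0)) p) 0 0 t := by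
      intro t
      rw [← dirPoly_sub, ← dirPoly_add, zero_add]
    have hcoeff := sum_coeff_sq_le (M := M₀) (a := 4 / ℓ) (fun n ↦ smoothing ℓ (Real.log n)) hwf0 hwf1 hwfy hy2 hyM (by positivity)
    have hms := integral_norm_sq_dirPoly_le hSsub
      (fun p ↦ ((fun n ↦ smoothing ℓ (Real.log n))) p * Real.exp (-(4 / ℓ * Real.log p)) - ((fun n : ℕ ↦ if n ≤ ⌊y⌋₊ then (1 : ℝ) else 0)) p) 0 0 T
    have hcoeff' : ∑ n ∈ (Nat.primesLE M₀), Real.log n ^ (2 * 0) *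
        (((fun n ↦ smoothing ℓ (Real.log n))) n * Real.exp (-(4 / ℓ * Real.log n)) - ((fun n : ℕ ↦ if n ≤ ⌊y⌋₊ then (1 : ℝ) else 0)) n) ^ 2 * (n : ℝ) ^ (-(1 + 2 * (0 : ℝ))) ≤ 26 := by
      have e : ∑ n ∈ (Nat.primesLE M₀), Real.log n ^ (2 * 0) *
          (((fun n ↦ smoothing ℓ (Real.log n))) n * Real.exp (-(4 / ℓ * Real.log n)) - ((fun n : ℕ ↦ if n ≤ ⌊y⌋₊ then (1 : ℝ) else 0)) n) ^ 2 * (n : ℝ) ^ (-(1 + 2 * (0 : ℝ))) =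
          ∑ p ∈ Nat.primesLE M₀, (smoothing ℓ (Real.log p) * Real.exp (-(4 / ℓ * Real.log p)) -
            if p ≤ ⌊y⌋₊ then 1 else 0) ^ 2 * (p : ℝ)⁻¹ := by
        refine Finset.sum_congr rfl fun p _ ↦ ?_
        rw [mul_zero, pow_zero, one_mul, mul_zero, add_zero, Real.rpow_neg_one]
      rw [e]
      refine hcoeff.trans ?_
      -- `a² log y (log y + 2) ≤ 20`, `log log M₀ − log log y ≤ 2`, `16/log y ≤ 4`
      have h1 : (4 / ℓ) ^ 2 * (Real.log y * (Real.log y + 2)) ≤ 20 := by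
        have : Real.log y * (Real.log y + 2) ≤ ℓ * (ℓ + 2) := by nlinarith only [hlogy2, hly0]
        have h32 : 32 / ℓ ≤ 4 := by rw [div_le_iff₀ hℓ0]; linarith only [hℓ8]
        calc (4 / ℓ) ^ 2 * (Real.log y * (Real.log y + 2)) ≤ (4 / ℓ) ^ 2 * (ℓ * (ℓ + 2)) :=
              mul_le_mul_of_nonneg_left this (sq_nonneg _)
          _ = 16 + 32 / ℓ := by field_simp; ring
          _ ≤ 20 := by linarith only [h32]
      have h2 : Real.log (Real.log (M₀ : ℝ)) - Real.log (Real.log y) ≤ 2 := by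
        have hlM : Real.log (M₀ : ℝ) ≤ 3 * ℓ := by
          calc Real.log (M₀ : ℝ) ≤ Real.log (Real.exp (3 * ℓ)) := Real.log_le_log hM₀pos hM₀le
            _ = 3 * ℓ := Real.log_exp _
        have hlMy : Real.log y ≤ Real.log (M₀ : ℝ) := Real.log_le_log hypos hyM
        have hq : Real.log (Real.log (M₀ : ℝ)) - Real.log (Real.log y) =
            Real.log (Real.log (M₀ : ℝ) / Real.log y) := by
          rw [Real.log_div (by linarith only [hlMy, hly0]) hly0.ne']
        rw [hq]
        have hr : Real.log (M₀ : ℝ) / Real.log y ≤ 6 := by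
          rw [div_le_iff₀ hly0]; linarith only [hlM, hlogy1]
        have hr0 : 0 < Real.log (M₀ : ℝ) / Real.log y := div_pos (by linarith only [hlMy, hly0]) hly0
        calc Real.log (Real.log (M₀ : ℝ) / Real.log y) ≤ Real.log 6 := Real.log_le_log hr0 hr
          _ ≤ 2 := by
              rw [Real.log_le_iff_le_exp (by norm_num)]
              have h1 := Real.exp_one_gt_d9
              have h2 : Real.exp 2 = Real.exp 1 * Real.exp 1 := by rw [← Real.exp_add]; norm_num
              nlinarith only [h1, h2]
      have h3 : 16 / Real.log y ≤ 4 := by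
        rw [div_le_iff₀ hly0]; linarith only [hlogy1, hℓ8]
      linarith only [h1, h2, h3]
    have hfixint : ∫ t in T / 2..T, ‖dirPoly (Nat.primesLE M₀) (fun n ↦ smoothing ℓ (Real.log n)) 0 (4 / ℓ) t - dirPoly (Nat.primesLE M₀) (fun n : ℕ ↦ if n ≤ ⌊y⌋₊ then (1 : ℝ) else 0) 0 0 t‖ ^ 2 ≤ 26 * T := by
      have e : ∫ t in T / 2..T, ‖dirPoly (Nat.primesLE M₀) (fun n ↦ smoothing ℓ (Real.log n)) 0 (4 / ℓ) t - dirPoly (Nat.primesLE M₀) (fun n : ℕ ↦ if n ≤ ⌊y⌋₊ then (1 : ℝ) else 0) 0 0 t‖ ^ 2 =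
          ∫ t in T / 2..T, ‖dirPoly (Nat.primesLE M₀) (fun p ↦ ((fun n ↦ smoothing ℓ (Real.log n))) p * Real.exp (-(4 / ℓ * Real.log p)) - ((fun n : ℕ ↦ if n ≤ ⌊y⌋₊ then (1 : ℝ) else 0)) p)
            0 0 t‖ ^ 2 :=
        intervalIntegral.integral_congr fun t _ ↦ by rw [hfix t]
      rw [e]
      refine hms.trans ?_
      have h0 : 0 ≤ ∑ n ∈ (Nat.primesLE M₀), Real.log n ^ (2 * 0) *
          (((fun n ↦ smoothing ℓ (Real.log n))) n * Real.exp (-(4 / ℓ * Real.log n)) - ((fun n : ℕ ↦ if n ≤ ⌊y⌋₊ then (1 : ℝ) else 0)) n) ^ 2 * (n : ℝ) ^ (-(1 + 2 * (0 : ℝ))) :=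
        Finset.sum_nonneg fun n _ ↦ by
          have : 0 ≤ (n : ℝ) ^ (-(1 + 2 * (0 : ℝ))) := Real.rpow_nonneg (Nat.cast_nonneg n) _
          positivity
      calc (T / 2 + 8 * (M₀ : ℝ) * (1 + Real.log (M₀ : ℝ))) *
            ∑ n ∈ (Nat.primesLE M₀), Real.log n ^ (2 * 0) *
              (((fun n ↦ smoothing ℓ (Real.log n))) n * Real.exp (-(4 / ℓ * Real.log n)) - ((fun n : ℕ ↦ if n ≤ ⌊y⌋₊ then (1 : ℝ) else 0)) n) ^ 2 * (n : ℝ) ^ (-(1 + 2 * (0 : ℝ)))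
          ≤ T * 26 := mul_le_mul hTM hcoeff' h0 hT0.le
        _ = 26 * T := mul_comm _ _
    have e : ∫ t in T / 2..T, ‖P t‖ ^ 2 =
        ∫ t in T / 2..T, ‖dirPoly (Nat.primesLE M₀) (fun n ↦ smoothing ℓ (Real.log n)) 0 (SelbergSigma.delta ℓ t) t - dirPoly (Nat.primesLE M₀) (fun n : ℕ ↦ if n ≤ ⌊y⌋₊ then (1 : ℝ) else 0) 0 0 t‖ ^ 2 :=
      intervalIntegral.integral_congr fun t _ ↦ by rw [hP_eq]
    rw [e]
    calc ∫ t in T / 2..T, ‖dirPoly (Nat.primesLE M₀) (fun n ↦ smoothing ℓ (Real.log n)) 0 (SelbergSigma.delta ℓ t) t - dirPoly (Nat.primesLE M₀) (fun n : ℕ ↦ if n ≤ ⌊y⌋₊ then (1 : ℝ) else 0) 0 0 t‖ ^ 2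
        ≤ 2 * (∫ t in T / 2..T, ‖dirPoly (Nat.primesLE M₀) (fun n ↦ smoothing ℓ (Real.log n)) 0 (4 / ℓ) t - dirPoly (Nat.primesLE M₀) (fun n : ℕ ↦ if n ≤ ⌊y⌋₊ then (1 : ℝ) else 0) 0 0 t‖ ^ 2) +
            8 * (Real.sqrt K₄' * Real.sqrt T / ℓ ^ 2) * Real.sqrt T * ℓ ^ 2 := h
      _ ≤ 2 * (26 * T) + 8 * (Real.sqrt K₄' * Real.sqrt T / ℓ ^ 2) * Real.sqrt T * ℓ ^ 2 :=
          add_le_add (mul_le_mul_of_nonneg_left hfixint (by norm_num : (0 : ℝ) ≤ 2)) le_rfl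
      _ = (52 + 8 * Real.sqrt K₄') * T := by
          have hℓ2 : ℓ ^ 2 ≠ 0 := by positivity
          have e1 : 8 * (Real.sqrt K₄' * Real.sqrt T / ℓ ^ 2) * Real.sqrt T * ℓ ^ 2 =
              8 * Real.sqrt K₄' * (Real.sqrt T * Real.sqrt T) * (ℓ ^ 2 / ℓ ^ 2) := by ring
          rw [e1, hsqT, div_self hℓ2]
          ring
  -- (iv) `∫ ‖Qn‖²`
  have hInt4 : ∫ t in T / 2..T, ‖Qn t‖ ^ 2 ≤ (8 + 2 * K₂' / θ ^ 2) * T := by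
    have hpt4 : ∀ t ∈ Icc (T / 2) T, ‖Qn t‖ ^ 2 ≤ 2 * ‖Qn0 t‖ ^ 2 + 2 * L ^ 2 * SelbergSigma.delta ℓ t ^ 2 := by
      intro t _
      have h1 : ‖Qn t - Qn0 t‖ ≤ SelbergSigma.delta ℓ t * (4 * Real.log ((M₀ + 1 : ℕ) : ℝ) + 6) := by
        rw [hQn_eq, hQn0_eq]; exact norm_Qnp_sub_le M₀ hℓ0 (hδ0 t) t
      have h2 : ‖Qn t - Qn0 t‖ ≤ SelbergSigma.delta ℓ t * L := h1.trans (mul_le_mul_of_nonneg_left h46 (hδ0 t))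
      have h3 : ‖Qn t‖ ≤ ‖Qn0 t‖ + SelbergSigma.delta ℓ t * L := by
        have : Qn t = Qn0 t + (Qn t - Qn0 t) := by ring
        calc ‖Qn t‖ = ‖Qn0 t + (Qn t - Qn0 t)‖ := by rw [← this]
          _ ≤ ‖Qn0 t‖ + ‖Qn t - Qn0 t‖ := norm_add_le _ _
          _ ≤ ‖Qn0 t‖ + SelbergSigma.delta ℓ t * L := by linarith only [h2]
      have h4 : 0 ≤ ‖Qn0 t‖ + SelbergSigma.delta ℓ t * L :=
        add_nonneg (norm_nonneg _) (mul_nonneg (hδ0 t) hL0.le)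
      calc ‖Qn t‖ ^ 2 ≤ (‖Qn0 t‖ + SelbergSigma.delta ℓ t * L) ^ 2 := pow_le_pow_left₀ (norm_nonneg _) h3 2
        _ ≤ 2 * ‖Qn0 t‖ ^ 2 + 2 * L ^ 2 * SelbergSigma.delta ℓ t ^ 2 := by
            nlinarith only [sq_nonneg (‖Qn0 t‖ - SelbergSigma.delta ℓ t * L)]
    have hI0a : IntervalIntegrable (fun t ↦ 2 * ‖Qn0 t‖ ^ 2) volume (T / 2) T :=
      ((hQn0c.norm.pow 2).const_mul 2).intervalIntegrable _ _
    have hI0 : IntervalIntegrable (fun t ↦ 2 * ‖Qn0 t‖ ^ 2 + 2 * L ^ 2 * SelbergSigma.delta ℓ t ^ 2) volume (T / 2) T :=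
      hI0a.add (hI2.const_mul _)
    have hms := integral_norm_sq_dirPoly_le hAsub (fun n ↦ ArithmeticFunction.vonMangoldt n * smoothing ℓ (Real.log n) / Real.log n) 0 0 T
    have hcoeff := sum_Qnp_coeff_sq_le M₀ hℓ0
    have hQn0int : ∫ t in T / 2..T, ‖Qn0 t‖ ^ 2 ≤ 4 * T := by
      have e : ∫ t in T / 2..T, ‖Qn0 t‖ ^ 2 = ∫ t in T / 2..T, ‖dirPoly ((Finset.Ico 2 (M₀ + 1)).filter (fun n ↦ ¬ n.Prime)) (fun n ↦ ArithmeticFunction.vonMangoldt n * smoothing ℓ (Real.log n) / Real.log n) 0 0 t‖ ^ 2 :=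
        intervalIntegral.integral_congr fun t _ ↦ by rw [hQn0_eq]
      rw [e]
      refine hms.trans ?_
      have h0 : 0 ≤ ∑ n ∈ ((Finset.Ico 2 (M₀ + 1)).filter (fun n ↦ ¬ n.Prime)), Real.log n ^ (2 * 0) *
          (ArithmeticFunction.vonMangoldt n * smoothing ℓ (Real.log n) / Real.log n) ^ 2 *
            (n : ℝ) ^ (-(1 + 2 * (0 : ℝ))) := Finset.sum_nonneg fun n _ ↦ by
        have : 0 ≤ (n : ℝ) ^ (-(1 + 2 * (0 : ℝ))) := Real.rpow_nonneg (Nat.cast_nonneg n) _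
        positivity
      calc (T / 2 + 8 * (M₀ : ℝ) * (1 + Real.log (M₀ : ℝ))) *
            ∑ n ∈ ((Finset.Ico 2 (M₀ + 1)).filter (fun n ↦ ¬ n.Prime)), Real.log n ^ (2 * 0) *
              (ArithmeticFunction.vonMangoldt n * smoothing ℓ (Real.log n) / Real.log n) ^ 2 *
                (n : ℝ) ^ (-(1 + 2 * (0 : ℝ)))
          ≤ T * 4 := mul_le_mul hTM hcoeff h0 hT0.le
        _ = 4 * T := mul_comm _ _
    calc ∫ t in T / 2..T, ‖Qn t‖ ^ 2 ≤ ∫ t in T / 2..T, (2 * ‖Qn0 t‖ ^ 2 + 2 * L ^ 2 * SelbergSigma.delta ℓ t ^ 2) :=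
          intervalIntegral.integral_mono_on hTT hI4 hI0 hpt4
      _ = 2 * (∫ t in T / 2..T, ‖Qn0 t‖ ^ 2) + 2 * (L ^ 2 * ∫ t in T / 2..T, SelbergSigma.delta ℓ t ^ 2) := by
          rw [intervalIntegral.integral_add hI0a (hI2.const_mul _), intervalIntegral.integral_const_mul,
            intervalIntegral.integral_const_mul]
          ring
      _ ≤ 2 * (4 * T) + 2 * (K₂' / θ ^ 2 * T) :=
          add_le_add (mul_le_mul_of_nonneg_left hQn0int (by norm_num : (0 : ℝ) ≤ 2))
            (mul_le_mul_of_nonneg_left hInt2 (by norm_num : (0 : ℝ) ≤ 2))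
      _ = (8 + 2 * K₂' / θ ^ 2) * T := by ring
  -- Step 4: conclusion
  have hRint : ∫ t in T / 2..T, R t =
      2 * C₀ ^ 2 * ((∫ t in T / 2..T, SelbergSigma.delta ℓ t ^ 2 * ‖Q1 t‖ ^ 2) +
        4 * (L ^ 2 * ∫ t in T / 2..T, SelbergSigma.delta ℓ t ^ 2)) +
        (∫ t in T / 2..T, ‖P t‖ ^ 2) + ∫ t in T / 2..T, ‖Qn t‖ ^ 2 := by
    have e : ∫ t in T / 2..T, R t = ∫ t in T / 2..T,
        (2 * C₀ ^ 2 * (SelbergSigma.delta ℓ t ^ 2 * ‖Q1 t‖ ^ 2 + 4 * L ^ 2 * SelbergSigma.delta ℓ t ^ 2) + ‖P t‖ ^ 2 + ‖Qn t‖ ^ 2) :=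
      intervalIntegral.integral_congr fun t _ ↦ by rw [hR_eq]
    rw [e, intervalIntegral.integral_add (hIA.add hI3) hI4, intervalIntegral.integral_add hIA hI3,
      intervalIntegral.integral_const_mul, intervalIntegral.integral_add hI1 (hI2.const_mul _),
      intervalIntegral.integral_const_mul]
    ring
  have hC₀2 : 0 ≤ 2 * C₀ ^ 2 := by positivity
  have eE : ∫ t in T / 2..T, (zetaArgS t + π⁻¹ * ∑ p ∈ Nat.primesLE ⌊y⌋₊,
      Real.sin (t * Real.log p) / Real.sqrt p) ^ 2 = ∫ t in T / 2..T, E t ^ 2 :=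
    intervalIntegral.integral_congr fun t _ ↦ by rw [hE_eq]
  rw [eE]
  calc ∫ t in T / 2..T, E t ^ 2 ≤ ∫ t in T / 2..T, R t := hmono
    _ = _ := hRint
    _ ≤ 2 * C₀ ^ 2 * ((11 * Real.sqrt K₄' + 6 * Real.sqrt K₆') * T + 4 * (K₂' / θ ^ 2 * T)) +
          (52 + 8 * Real.sqrt K₄') * T + (8 + 2 * K₂' / θ ^ 2) * T :=
        add_le_add (add_le_add (mul_le_mul_of_nonneg_left
          (add_le_add hInt1 (mul_le_mul_of_nonneg_left hInt2 (by norm_num : (0 : ℝ) ≤ 4))) hC₀2) hInt3) hInt4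
    _ = Cfin * T := by rw [hCfin]; ring

/-- **Selberg–Fujii large gaps from the zero-density theorem near the critical line**: the named fact
`Literature.NumberTheory.LFunctions.selberg_fujii_large_gaps` (Titchmarsh (9.25.5)) follows from
`N(σ, T) ≤ C T^{1−κ(σ−1/2)} log T` (`T ≥ T₀`, `1/2 ≤ σ ≤ 1`, some `κ > 0`; Titchmarsh Thm. 9.19 (C),
Selberg 1946 Thm. 1), through `approxFormula_meanSquare_of_zeroDensity` and
`selberg_fujii_large_gaps_of_approxFormula`. [cite: Titchmarsh1986, §9.25] -/
theorem selberg_fujii_large_gaps_of_zeroDensity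
    (hD : ∃ κ : ℝ, 0 < κ ∧ ∃ C T₀ : ℝ, ∀ T : ℝ, T₀ ≤ T → ∀ σ : ℝ, 1 / 2 ≤ σ → σ ≤ 1 →
      (zetaZeroCountRe σ T : ℝ) ≤ C * T ^ (1 - κ * (σ - 1 / 2)) * Real.log T) :
    selberg_fujii_large_gaps :=
  selberg_fujii_large_gaps_of_approxFormula (approxFormula_meanSquare_of_zeroDensity hD)

/-- **Selberg–Fujii small gaps from the zero-density theorem near the critical line**: the named fact
`Literature.NumberTheory.LFunctions.selberg_fujii_small_gaps` (Titchmarsh (9.25.6)) follows from the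
same density hypothesis. [cite: Titchmarsh1986, §9.25] -/
theorem selberg_fujii_small_gaps_of_zeroDensity
    (hD : ∃ κ : ℝ, 0 < κ ∧ ∃ C T₀ : ℝ, ∀ T : ℝ, T₀ ≤ T → ∀ σ : ℝ, 1 / 2 ≤ σ → σ ≤ 1 →
      (zetaZeroCountRe σ T : ℝ) ≤ C * T ^ (1 - κ * (σ - 1 / 2)) * Real.log T) :
    selberg_fujii_small_gaps :=
  selberg_fujii_small_gaps_of_approxFormula (approxFormula_meanSquare_of_zeroDensity hD)

/-- The density hypothesis in the *near-line* form `N(σ, T) ≤ C T^{1−κ(σ−1/2)} log T` for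
`1/2 ≤ σ ≤ 1/2 + η₀` only (`η₀ > 0`) already implies the full-range form (with `κ` replaced by
`2κη₀ ∧ κ`), since `N(σ, T)` is non-increasing in `σ`. [folklore] -/
theorem zeroDensity_of_nearLine {κ η₀ C T₀ : ℝ} (hκ : 0 < κ) (hη₀ : 0 < η₀) (hη₁ : η₀ ≤ 1 / 2) (hC : 0 ≤ C)
    (hD : ∀ T : ℝ, T₀ ≤ T → ∀ σ : ℝ, 1 / 2 ≤ σ → σ ≤ 1 / 2 + η₀ →
      (zetaZeroCountRe σ T : ℝ) ≤ C * T ^ (1 - κ * (σ - 1 / 2)) * Real.log T) :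
    ∃ κ' : ℝ, 0 < κ' ∧ ∃ C' T₀' : ℝ, ∀ T : ℝ, T₀' ≤ T → ∀ σ : ℝ, 1 / 2 ≤ σ → σ ≤ 1 →
      (zetaZeroCountRe σ T : ℝ) ≤ C' * T ^ (1 - κ' * (σ - 1 / 2)) * Real.log T := by
  refine ⟨2 * κ * η₀, by positivity, C, max T₀ 1, fun T hT σ h1 h2 ↦ ?_⟩
  have hT₀ : T₀ ≤ T := (le_max_left _ _).trans hT
  have hT1 : 1 ≤ T := (le_max_right _ _).trans hT
  have hlog : 0 ≤ Real.log T := Real.log_nonneg hT1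
  rcases le_or_gt σ (1 / 2 + η₀) with hσ | hσ
  · refine (hD T hT₀ σ h1 hσ).trans ?_
    have hprod : 0 ≤ κ * (σ - 1 / 2) * (1 - 2 * η₀) :=
      mul_nonneg (mul_nonneg hκ.le (by linarith)) (by linarith)
    have : T ^ (1 - κ * (σ - 1 / 2)) ≤ T ^ (1 - 2 * κ * η₀ * (σ - 1 / 2)) :=
      Real.rpow_le_rpow_of_exponent_le hT1 (by nlinarith [hprod])
    gcongr
  · -- `N(σ, T) ≤ N(1/2 + η₀, T) ≤ C T^{1 − κη₀} log T ≤ C T^{1 − 2κη₀(σ − 1/2)} log T`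
    have hmono : (zetaZeroCountRe σ T : ℝ) ≤ (zetaZeroCountRe (1 / 2 + η₀) T : ℝ) := by
      exact_mod_cast zetaZeroCountRe_anti_left_holds T hσ.le
    refine hmono.trans ((hD T hT₀ (1 / 2 + η₀) (by linarith) le_rfl).trans ?_)
    have hprod : 0 ≤ κ * η₀ * (1 - 2 * (σ - 1 / 2)) :=
      mul_nonneg (mul_nonneg hκ.le hη₀.le) (by linarith)
    have : T ^ (1 - κ * (1 / 2 + η₀ - 1 / 2)) ≤ T ^ (1 - 2 * κ * η₀ * (σ - 1 / 2)) :=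
      Real.rpow_le_rpow_of_exponent_le hT1 (by nlinarith [hprod])
    gcongr

end SelbergMeanSquare

end Literature.NumberTheory.LFunctions

end
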